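import Literature.Computability.Complexity.Williams2014
import Literature.Computability.MetaComplexity.TruthTables
import HarnessLib

/-!
# The OR of the restrictions of a circuit to its first `ℓ` inputs (Williams 2014, Thm. 4.1)

Literature / circuit complexity, a component of Williams' `ACC`-SAT algorithm
(R. Williams, *Nonuniform ACC circuit lower bounds*, J. ACM 61 (2014), proof of Thm. 4.1:
"Make a circuit `C'` with `s · 2^ℓ` size and `n − ℓ` inputs which is obtained by producing
`2^ℓ` copies of `C`, plugging in a different possible assignment to the first `ℓ` inputs of `C`
in each copy, and taking the OR of these copies. Observe `C'` is a depth-`(d + 1)` `ACC`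
circuit, and `C` is satisfiable if and only if `C'` is satisfiable"). Everything is proved, and
the construction is an explicit function on the tree's straight-line circuits so that a machine
emitting it gate by gate (the driver of `Williams2014_thm_4_1`, `Williams2014AccSat.lean`) can
be specified against it:

* `GateList.hwGates C σ`, `GateList.hwOut C σ` — the **hard-wiring block** of a circuit `C`
  along a re-addressing `σ : ι' → ι ⊕ Bool` of its inputs (the two constant gates `∨₀, ∧₀`
  first, then the gates of `C` relocated by `2` with inputs sent to new inputs or to the
  constants; the explicit form of `Circuit.exists_hardwire` of `Williams2014.lean`), with its
  well-formedness, basis, size `= C.size + 2`, arities, value (`wireOf_hwOut`) and depth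
  (`≤ C.acDepth + 1`, the constants being gates of depth `1` in the tree's model);
* `Circuit.orRestrictions C ℓ : Circuit (Fin (n - ℓ))` — the `2^ℓ` blocks for the assignments
  `v = (boolFunEquivFin ℓ)⁻¹ a`, `a < 2^ℓ` (binary, least significant digit first), of the first
  `ℓ` inputs, laid side by side (`GateList.parBlocks`) and fed into one `∨_{2^ℓ}` gate;
* `Circuit.eval_orRestrictions` — `C'(y) = ⋁_v C(v, y)` (`plugAssign ℓ v y` is the assignment
  "`v` on the inputs `< ℓ`, `y` on the inputs `≥ ℓ`"), hence
  `Circuit.satisfiable_orRestrictions_iff : C'.Satisfiable ↔ C.Satisfiable`;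
* the bookkeeping: `IsOver B` for any `B ⊇ acBasis` containing the gates of `C` (so `AC⁰[m]`
  stays `AC⁰[m]`), `size = 2^ℓ · (C.size + 2) + 1`, `acDepth ≤ C.acDepth + 2`,
  `maxFanIn ≤ max C.maxFanIn 2^ℓ`.

## Faithfulness notes

Williams counts depth `d + 1` and size `s · 2^ℓ` because plugging constants into inputs is free
in his model; in the tree's model constants are the gates `∨₀`/`∧₀` (depth `1`), whence
`acDepth ≤ d + 2` and `2` extra gates per copy — immaterial for the algorithm (Lemma 4.1 is
applied at depth `d + 2` instead of `d + 1`).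

## References

* R. Williams, *Nonuniform ACC circuit lower bounds*, J. ACM 61(1) (2014), proof of Thm. 4.1
  [Williams2014].
* H. Vollmer, *Introduction to Circuit Complexity*, Springer 1999, §1.2 (substitution of
  constants and circuits for inputs) [Vollmer1999].
-/

namespace Literature.Computability.Complexity

open Finset GateList MetaComplexity

variable {ι ι' : Type*}

/-! ### Bounding the fan-in gate by gate -/

/-- `C.maxFanIn ≤ K` iff every gate of `C` has arity `≤ K` (`maxFanIn` is the `foldr max 0` of
the arities). [folklore] -/
theorem Circuit.maxFanIn_le_iff (C : Circuit ι) (K : ℕ) :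
    C.maxFanIn ≤ K ↔ ∀ g ∈ C.gates, g.arity ≤ K := by
  suffices h : ∀ l : List (Gate ι), (l.map Gate.arity).foldr max 0 ≤ K ↔ ∀ g ∈ l, g.arity ≤ K from
    h C.gates
  intro l
  induction l with
  | nil => simp
  | cons g l ih => simp [ih]

namespace GateList

/-! ### The hard-wiring block -/

/-- The two constant gates `∨₀ = 0`, `∧₀ = 1` placed in front of a hard-wired copy. [folklore] -/
def hwPre : List (Gate ι) := [constGate ι false, constGate ι true]

/-- `hwPre` has two gates. [folklore] -/
@[simp] theorem length_hwPre : (hwPre : List (Gate ι)).length = 2 := rfl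

/-- The re-addressing of the inputs of the copy as wires behind `hwPre`: a new input `inl i`, or
the constant gate `0`/`1`. [folklore] -/
def hwWire (σ : ι' → ι ⊕ Bool) : ι' → ι ⊕ ℕ :=
  fun j => Sum.elim Sum.inl (fun b => Sum.inr (cond b 1 0)) (σ j)

/-- **The hard-wiring block** of `C` along `σ`: the constants, then the gates of `C` relocated
behind them with inputs re-addressed by `hwWire σ` (Williams 2014, proof of Thm. 4.1:
"plugging in a … assignment to the first `ℓ` inputs of `C` in each copy"; Vollmer 1999, §1.2).
[cite: Williams2014, Thm. 4.1] -/
def hwGates (C : Circuit ι') (σ : ι' → ι ⊕ Bool) : List (Gate ι) :=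
  hwPre ++ C.gates.map (reloc (hwWire σ) (hwPre : List (Gate ι)).length)

/-- The output wire of the hard-wiring block. [cite: Williams2014, Thm. 4.1] -/
def hwOut (C : Circuit ι') (σ : ι' → ι ⊕ Bool) : ι ⊕ ℕ :=
  shiftWire (hwWire σ) (hwPre : List (Gate ι)).length C.output

/-- The re-addressed wires only refer to the two constants. [folklore] -/
theorem wiresOK_hwWire (σ : ι' → ι ⊕ Bool) : WiresOK (hwPre : List (Gate ι)).length (hwWire σ) := by
  intro j m hj
  unfold hwWire at hj
  cases hσ : σ j with
  | inl i => rw [hσ] at hj; cases hj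
  | inr b =>
    rw [hσ] at hj
    simp only [Sum.elim_inr, Sum.inr.injEq] at hj
    subst hj
    cases b <;> simp

/-- The constants form a well-formed gate list. [folklore] -/
theorem wf_hwPre : WF (hwPre : List (Gate ι)) := by
  intro j g hj a
  have : g ∈ (hwPre : List (Gate ι)) := List.mem_of_getElem? hj
  simp only [hwPre, List.mem_cons, List.not_mem_nil, or_false] at this
  rcases this with rfl | rfl <;> exact a.elim0

/-- The hard-wiring block is well formed. [folklore] -/
theorem wf_hwGates (C : Circuit ι') (σ : ι' → ι ⊕ Bool) : WF (hwGates C σ) :=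
  wf_hwPre.append_reloc (wf_gates C) (wiresOK_hwWire σ)

/-- The hard-wiring block has `C.size + 2` gates. [folklore] -/
@[simp] theorem length_hwGates (C : Circuit ι') (σ : ι' → ι ⊕ Bool) :
    (hwGates C σ : List (Gate ι)).length = C.size + 2 := by
  simp only [hwGates, List.length_append, length_hwPre, List.length_map, Circuit.size]
  omega

/-- The gates of the block are the two constants and the gates of `C`: over any basis containing
`∨₀`, `∧₀` and the gates of `C`. [folklore] -/
theorem fn_mem_hwGates {B : Set GateFn} (hF : GateFn.or 0 ∈ B) (hT : GateFn.and 0 ∈ B)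
    {C : Circuit ι'} (hC : C.IsOver B) (σ : ι' → ι ⊕ Bool) : ∀ g ∈ hwGates C σ, g.fn ∈ B := by
  intro g hg
  simp only [hwGates, hwPre, List.cons_append, List.nil_append, List.mem_cons, List.mem_map] at hg
  rcases hg with rfl | rfl | ⟨g', hg', rfl⟩
  · rw [constGate_fn, GateFn.const_false_eq_or_zero]; exact hF
  · rw [constGate_fn, GateFn.const_true_eq_and_zero]; exact hT
  · rw [reloc_fn]; exact hC g' hg'

/-- The arities in the block are those of `C` (and `0` for the constants). [folklore] -/
theorem arity_le_of_mem_hwGates (C : Circuit ι') (σ : ι' → ι ⊕ Bool) :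
    ∀ g ∈ hwGates C σ, g.arity ≤ C.maxFanIn := by
  intro g hg
  simp only [hwGates, hwPre, List.cons_append, List.nil_append, List.mem_cons, List.mem_map] at hg
  rcases hg with rfl | rfl | ⟨g', hg', rfl⟩
  · exact Nat.zero_le _
  · exact Nat.zero_le _
  · exact (Circuit.maxFanIn_le_iff C _).1 le_rfl g' hg'

/-- The output wire of the block is a valid wire. [folklore] -/
theorem outOK_hwOut (C : Circuit ι') (σ : ι' → ι ⊕ Bool) :
    OutOK (hwGates C σ : List (Gate ι)).length (hwOut C σ) := by
  intro m hm
  unfold hwOut at hm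
  cases hout : C.output with
  | inl j =>
    rw [hout] at hm
    exact ((wiresOK_hwWire (ι := ι) σ) j m hm).trans_le (by simp)
  | inr m' =>
    rw [hout] at hm
    simp only [shiftWire, Sum.inr.injEq, length_hwPre] at hm
    have := C.wf_output m' hout
    rw [length_hwGates]
    simp only [Circuit.size]
    omega

/-- **Value of the hard-wiring block**: its output wire carries `C` evaluated at the re-addressed
assignment (new inputs read from `x`, constants as prescribed by `σ`) (Vollmer 1999, §1.2).
[cite: Williams2014, Thm. 4.1] -/
theorem wireOf_hwOut (C : Circuit ι') (σ : ι' → ι ⊕ Bool) (x : ι → Bool) :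
    wireOf x (vals (hwGates C σ) x) (hwOut C σ) = C.eval fun j => Sum.elim x id (σ j) := by
  rw [circuit_eval C]
  unfold hwGates hwOut
  rw [vals_append_reloc hwPre C.gates (hwWire σ) (wiresOK_hwWire σ) x,
    wireOf_shiftWire x (vals hwPre x) _ (length_vals hwPre x) (hwWire σ) (wiresOK_hwWire σ) C.output]
  have hassign : (fun i => wireOf x (vals (hwPre : List (Gate ι)) x) (hwWire σ i)) =
      fun j => Sum.elim x id (σ j) := by
    funext j
    simp only [hwWire]
    cases σ j with
    | inl i => rfl
    | inr b => cases b <;> rfl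
  rw [hassign]

/-- The constants have depth `1`. [folklore] -/
theorem wdepths_hwPre : wdepths acWeight (hwPre : List (Gate ι)) = [1, 1] := by
  simp [hwPre, wdepths]
  exact ⟨fun i => Fin.elim0 i, fun i => Fin.elim0 i⟩

/-- Every re-addressed input wire has depth at most `1` behind the constants. [folklore] -/
theorem wireDepthOf_hwWire_le (σ : ι' → ι ⊕ Bool) (i : ι') :
    wireDepthOf (wdepths acWeight (hwPre : List (Gate ι))) (hwWire σ i) ≤ 1 := by
  rw [wdepths_hwPre]
  unfold hwWire
  cases σ i with
  | inl i' => simp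
  | inr b => cases b <;> simp

/-- **Depth of the hard-wiring block**: at most `C.acDepth + 1` (the constants are gates of
depth `1`; Vollmer 1999, §1.2). [cite: Williams2014, Thm. 4.1] -/
theorem wireDepthOf_hwOut_le (C : Circuit ι') (σ : ι' → ι ⊕ Bool) :
    wireDepthOf (wdepths acWeight (hwGates C σ : List (Gate ι))) (hwOut C σ) ≤ C.acDepth + 1 := by
  have hCd : C.acDepth = wireDepthOf (wdepths acWeight C.gates) C.output :=
    circuit_depthWith C acWeight
  have key := getD_wdepths_append_reloc_le acWeight (hwPre : List (Gate ι)) (hwWire σ)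
    (wiresOK_hwWire σ) 1 (wireDepthOf_hwWire_le σ) C.gates
  unfold hwGates hwOut
  cases hout : C.output with
  | inl j =>
    simp only [shiftWire]
    rw [wireDepthOf_wdepths_append acWeight hwPre _ (hwWire σ j) (wiresOK_hwWire σ j)]
    exact (wireDepthOf_hwWire_le σ j).trans (Nat.le_add_left 1 _)
  | inr m =>
    simp only [shiftWire, wireDepthOf_inr]
    rw [hCd, hout, wireDepthOf_inr, Nat.add_comm m]
    exact key m

end GateList

/-! ### Plugging an assignment into the first `ℓ` inputs -/

variable {n : ℕ}

/-- Re-addressing for the copy indexed by `v : Fin ℓ → Bool`: input `j < ℓ` becomes the constant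
`v j`, input `j ≥ ℓ` becomes the new input `j - ℓ`. [cite: Williams2014, Thm. 4.1] -/
def plugWire (n ℓ : ℕ) (v : Fin ℓ → Bool) : Fin n → Fin (n - ℓ) ⊕ Bool :=
  fun j => if h : (j : ℕ) < ℓ then Sum.inr (v ⟨j, h⟩) else Sum.inl ⟨j - ℓ, by have := j.2; omega⟩

/-- The assignment of the `n` inputs of `C` given by `v` on the inputs `< ℓ` and `y` on the
inputs `≥ ℓ`. [cite: Williams2014, Thm. 4.1] -/
def plugAssign (ℓ : ℕ) (v : Fin ℓ → Bool) (y : Fin (n - ℓ) → Bool) : Fin n → Bool :=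
  fun j => if h : (j : ℕ) < ℓ then v ⟨j, h⟩ else y ⟨j - ℓ, by have := j.2; omega⟩

/-- Reading the re-addressed wires off `y` gives `plugAssign ℓ v y`. [folklore] -/
theorem elim_plugWire (ℓ : ℕ) (v : Fin ℓ → Bool) (y : Fin (n - ℓ) → Bool) :
    (fun j => Sum.elim y id (plugWire n ℓ v j)) = plugAssign ℓ v y := by
  funext j
  unfold plugWire plugAssign
  split_ifs <;> rfl

/-- Every assignment of the `n` inputs is of the form `plugAssign ℓ v y`. [folklore] -/
theorem exists_plugAssign_eq (ℓ : ℕ) (x : Fin n → Bool) :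
    ∃ (v : Fin ℓ → Bool) (y : Fin (n - ℓ) → Bool), plugAssign ℓ v y = x := by
  refine ⟨fun j => if h : (j : ℕ) < n then x ⟨j, h⟩ else false,
    fun i => if h : (i : ℕ) + ℓ < n then x ⟨i + ℓ, h⟩ else false, ?_⟩
  funext j
  unfold plugAssign
  by_cases hj : (j : ℕ) < ℓ
  · rw [dif_pos hj]
    exact dif_pos j.2
  · rw [dif_neg hj]
    have h1 : (j : ℕ) - ℓ + ℓ < n := by have := j.2; omega
    dsimp only
    rw [dif_pos h1]
    congr 1
    exact Fin.ext (show (j : ℕ) - ℓ + ℓ = j by omega)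

/-! ### The OR of the `2^ℓ` restricted copies -/

namespace Circuit

/-- The copy of `C` for the assignment number `a < 2^ℓ` (digits `(boolFunEquivFin ℓ)⁻¹ a`, least
significant first) of the first `ℓ` inputs: its hard-wiring block. [cite: Williams2014, Thm. 4.1] -/
def orCopy (C : Circuit (Fin n)) (ℓ : ℕ) (a : Fin (2 ^ ℓ)) :
    List (Gate (Fin (n - ℓ))) × (Fin (n - ℓ) ⊕ ℕ) :=
  (hwGates C (plugWire n ℓ ((boolFunEquivFin ℓ).symm a)),
    hwOut C (plugWire n ℓ ((boolFunEquivFin ℓ).symm a)))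

/-- The `2^ℓ` copies, in the order `a = 0, 1, …, 2^ℓ - 1`. [cite: Williams2014, Thm. 4.1] -/
def orBlocks (C : Circuit (Fin n)) (ℓ : ℕ) : List (List (Gate (Fin (n - ℓ))) × (Fin (n - ℓ) ⊕ ℕ)) :=
  List.ofFn (orCopy C ℓ)

/-- There are `2^ℓ` copies. [folklore] -/
@[simp] theorem length_orBlocks (C : Circuit (Fin n)) (ℓ : ℕ) : (orBlocks C ℓ).length = 2 ^ ℓ :=
  List.length_ofFn

/-- The copies laid side by side: combined gate list and the `2^ℓ` output wires
(`GateList.parBlocks`). [cite: Williams2014, Thm. 4.1] -/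
def orBody (C : Circuit (Fin n)) (ℓ : ℕ) : List (Gate (Fin (n - ℓ))) × List (Fin (n - ℓ) ⊕ ℕ) :=
  parBlocks (orBlocks C ℓ)

/-- One output wire per copy. [folklore] -/
theorem length_orBody_snd (C : Circuit (Fin n)) (ℓ : ℕ) : (orBody C ℓ).2.length = 2 ^ ℓ := by
  rw [orBody, length_parBlocks_snd, length_orBlocks]

/-- The arguments of the final `∨` gate: the output wires of the copies. [cite: Williams2014, Thm. 4.1] -/
def orArgs (C : Circuit (Fin n)) (ℓ : ℕ) : Fin (2 ^ ℓ) → Fin (n - ℓ) ⊕ ℕ :=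
  fun a => (orBody C ℓ).2[a.1]'(by rw [length_orBody_snd]; exact a.2)

/-- The complete gate list: the copies, then one `∨_{2^ℓ}` gate. [cite: Williams2014, Thm. 4.1] -/
def orGates (C : Circuit (Fin n)) (ℓ : ℕ) : List (Gate (Fin (n - ℓ))) :=
  (orBody C ℓ).1 ++ [bigGate false (2 ^ ℓ) (orArgs C ℓ)]

/-- Every copy is well formed. [folklore] -/
theorem wf_of_mem_orBlocks (C : Circuit (Fin n)) (ℓ : ℕ) : ∀ b ∈ orBlocks C ℓ, WF b.1 := by
  intro b hb
  simp only [orBlocks, List.mem_ofFn] at hb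
  obtain ⟨a, rfl⟩ := hb
  exact wf_hwGates C _

/-- Every copy has a valid output wire. [folklore] -/
theorem outOK_of_mem_orBlocks (C : Circuit (Fin n)) (ℓ : ℕ) :
    ∀ b ∈ orBlocks C ℓ, OutOK b.1.length b.2 := by
  intro b hb
  simp only [orBlocks, List.mem_ofFn] at hb
  obtain ⟨a, rfl⟩ := hb
  exact outOK_hwOut C _

/-- The complete gate list is well formed. [folklore] -/
theorem wf_orGates (C : Circuit (Fin n)) (ℓ : ℕ) : WF (orGates C ℓ) :=
  (wf_parBlocks _ (wf_of_mem_orBlocks C ℓ)).append_singleton fun _ m hm =>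
    outOK_parBlocks _ (outOK_of_mem_orBlocks C ℓ) _ (List.getElem_mem _) m hm

/-- The output wire (the final gate) is valid. [folklore] -/
theorem outOK_orGates (C : Circuit (Fin n)) (ℓ : ℕ) :
    OutOK (orGates C ℓ).length (Sum.inr (orBody C ℓ).1.length : Fin (n - ℓ) ⊕ ℕ) := by
  intro m hm
  simp only [Sum.inr.injEq] at hm
  subst hm
  rw [orGates, List.length_append, List.length_singleton]
  exact Nat.lt_succ_self _

/-- **The OR of the `2^ℓ` restrictions of `C` to its first `ℓ` inputs** (Williams 2014, proof of
Thm. 4.1: "`C'` … is obtained by producing `2^ℓ` copies of `C`, plugging in a different possible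
assignment to the first `ℓ` inputs of `C` in each copy, and taking the OR of these copies"), a
circuit on the remaining `n - ℓ` inputs. [cite: Williams2014, Thm. 4.1] -/
def orRestrictions (C : Circuit (Fin n)) (ℓ : ℕ) : Circuit (Fin (n - ℓ)) :=
  toCircuit (orGates C ℓ) (Sum.inr (orBody C ℓ).1.length : Fin (n - ℓ) ⊕ ℕ) (wf_orGates C ℓ)
    (outOK_orGates C ℓ)

/-- The `a`-th copy is the `a`-th block. [folklore] -/
theorem getElem_orBlocks (C : Circuit (Fin n)) (ℓ : ℕ) (a : Fin (2 ^ ℓ)) :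
    (orBlocks C ℓ)[a.1]'(by rw [length_orBlocks]; exact a.2) = orCopy C ℓ a := by
  simp [orBlocks]

/-- The `a`-th argument wire of the final gate carries `C` evaluated at the `a`-th assignment of
the first `ℓ` inputs extended by `y`. [cite: Williams2014, Thm. 4.1] -/
theorem wireOf_orArgs (C : Circuit (Fin n)) (ℓ : ℕ) (y : Fin (n - ℓ) → Bool) (a : Fin (2 ^ ℓ)) :
    wireOf y (vals (orBody C ℓ).1 y) (orArgs C ℓ a) =
      C.eval (plugAssign ℓ ((boolFunEquivFin ℓ).symm a) y) := by
  have h : wireOf y (vals (orBody C ℓ).1 y) (orArgs C ℓ a) =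
      wireOf y (vals (orCopy C ℓ a).1 y) (orCopy C ℓ a).2 := by
    have h0 := wireOf_parBlocks y (orBlocks C ℓ) (outOK_of_mem_orBlocks C ℓ) a.1
      (by rw [← orBody, length_orBody_snd]; exact a.2) (by rw [length_orBlocks]; exact a.2)
    rw [getElem_orBlocks] at h0
    exact h0
  rw [h]
  unfold orCopy
  rw [wireOf_hwOut, elim_plugWire]

/-- **Semantics**: `C'(y) = ⋁_v C(v, y)` over the assignments `v` of the first `ℓ` inputs
(Williams 2014, proof of Thm. 4.1). [cite: Williams2014, Thm. 4.1] -/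
theorem eval_orRestrictions (C : Circuit (Fin n)) (ℓ : ℕ) (y : Fin (n - ℓ) → Bool) :
    (C.orRestrictions ℓ).eval y = decide (∃ v : Fin ℓ → Bool, C.eval (plugAssign ℓ v y) = true) := by
  rw [circuit_eval]
  change wireOf y (vals (orGates C ℓ) y) (Sum.inr (orBody C ℓ).1.length : Fin (n - ℓ) ⊕ ℕ) = _
  unfold orGates
  simp only [wireOf_inr]
  rw [vals_append_singleton, List.getD_eq_getElem?_getD,
    List.getElem?_append_right (by simp), length_vals, Nat.sub_self]
  simp only [List.getElem?_cons_zero, Option.getD_some, bigGate, Bool.false_eq_true, if_false,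
    GateFn.or]
  rw [Bool.eq_iff_iff]
  simp only [decide_eq_true_eq, wireOf_orArgs]
  exact ⟨fun ⟨a, ha⟩ => ⟨_, ha⟩, fun ⟨v, hv⟩ => ⟨boolFunEquivFin ℓ v, by simpa using hv⟩⟩

/-- **`C` is satisfiable iff `C'` is** (Williams 2014, proof of Thm. 4.1). [cite: Williams2014, Thm. 4.1] -/
theorem satisfiable_orRestrictions_iff (C : Circuit (Fin n)) (ℓ : ℕ) :
    (C.orRestrictions ℓ).Satisfiable ↔ C.Satisfiable := by
  constructor
  · rintro ⟨y, hy⟩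
    rw [eval_orRestrictions, decide_eq_true_eq] at hy
    obtain ⟨v, hv⟩ := hy
    exact ⟨_, hv⟩
  · rintro ⟨x, hx⟩
    obtain ⟨v, y, hvy⟩ := exists_plugAssign_eq ℓ x
    refine ⟨y, ?_⟩
    rw [eval_orRestrictions, decide_eq_true_eq]
    exact ⟨v, by rw [hvy]; exact hx⟩

/-- **Basis**: over any basis containing the unbounded fan-in `∧`/`∨`/`¬` gates and the gates
of `C` — in particular `C'` is an `AC⁰[m]` circuit when `C` is. [cite: Williams2014, Thm. 4.1] -/
theorem orRestrictions_isOver {B : Set GateFn} (hB : acBasis ⊆ B) {C : Circuit (Fin n)}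
    (hC : C.IsOver B) (ℓ : ℕ) : (C.orRestrictions ℓ).IsOver B := by
  intro g hg
  change g ∈ orGates C ℓ at hg
  unfold orGates at hg
  rw [List.mem_append, List.mem_singleton] at hg
  rcases hg with hg | rfl
  · refine fn_mem_parBlocks (orBlocks C ℓ) (fun b hb g' hg' => ?_) g hg
    simp only [orBlocks, List.mem_ofFn] at hb
    obtain ⟨a, rfl⟩ := hb
    exact fn_mem_hwGates (hB (or_mem_acBasis 0)) (hB (and_mem_acBasis 0)) hC _ g' hg'
  · simp only [bigGate_fn, Bool.false_eq_true, if_false]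
    exact hB (or_mem_acBasis _)

/-- `C'` is an `AC⁰[m]` circuit when `C` is. [cite: Williams2014, Thm. 4.1] -/
theorem orRestrictions_isOver_accBasis {m : ℕ} {C : Circuit (Fin n)} (hC : C.IsOver (accBasis m))
    (ℓ : ℕ) : (C.orRestrictions ℓ).IsOver (accBasis m) :=
  orRestrictions_isOver (acBasis_subset_accBasis m) hC ℓ

/-- **Size**: `2^ℓ` copies of `C.size + 2` gates and one `∨` gate (Williams: "`s · 2^ℓ` size",
constants being free there). [cite: Williams2014, Thm. 4.1] -/
theorem size_orRestrictions (C : Circuit (Fin n)) (ℓ : ℕ) :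
    (C.orRestrictions ℓ).size = 2 ^ ℓ * (C.size + 2) + 1 := by
  change (orGates C ℓ).length = _
  unfold orGates orBody
  rw [List.length_append, List.length_singleton, length_parBlocks_fst]
  simp [orBlocks, List.map_ofFn, Function.comp_def, orCopy]

/-- **Depth**: `acDepth C' ≤ acDepth C + 2` (one for the constants, one for the final `∨`;
Williams: depth `d + 1`). [cite: Williams2014, Thm. 4.1] -/
theorem acDepth_orRestrictions_le (C : Circuit (Fin n)) (ℓ : ℕ) :
    (C.orRestrictions ℓ).acDepth ≤ C.acDepth + 2 := by
  have hdepj : ∀ a : Fin (2 ^ ℓ),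
      wireDepthOf (wdepths acWeight (orBody C ℓ).1) (orArgs C ℓ a) ≤ C.acDepth + 1 := by
    intro a
    have h : wireDepthOf (wdepths acWeight (orBody C ℓ).1) (orArgs C ℓ a) =
        wireDepthOf (wdepths acWeight (orCopy C ℓ a).1) (orCopy C ℓ a).2 := by
      have h0 := wireDepthOf_parBlocks acWeight (orBlocks C ℓ) (outOK_of_mem_orBlocks C ℓ) a.1
        (by rw [← orBody, length_orBody_snd]; exact a.2) (by rw [length_orBlocks]; exact a.2)
      rw [getElem_orBlocks] at h0
      exact h0
    rw [h]
    exact wireDepthOf_hwOut_le C _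
  change Circuit.depthWith _ acWeight ≤ _
  rw [circuit_depthWith]
  change wireDepthOf (wdepths acWeight (orGates C ℓ))
    (Sum.inr (orBody C ℓ).1.length : Fin (n - ℓ) ⊕ ℕ) ≤ _
  unfold orGates
  simp only [wireDepthOf_inr]
  rw [getD_wdepths_append_singleton, bigGate_fn]
  have hw1 : acWeight (if false = true then GateFn.and (2 ^ ℓ) else GateFn.or (2 ^ ℓ)) = 1 := by
    simp
  rw [hw1, add_comm]
  exact Nat.add_le_add_right (Finset.sup_le fun a _ => hdepj a) 1

/-- **Fan-in**: the copies keep the arities of `C`, the final gate has fan-in `2^ℓ`. [cite: Williams2014, Thm. 4.1] -/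
theorem maxFanIn_orRestrictions_le (C : Circuit (Fin n)) (ℓ : ℕ) :
    (C.orRestrictions ℓ).maxFanIn ≤ max C.maxFanIn (2 ^ ℓ) := by
  rw [Circuit.maxFanIn_le_iff]
  intro g hg
  change g ∈ orGates C ℓ at hg
  unfold orGates at hg
  rw [List.mem_append, List.mem_singleton] at hg
  rcases hg with hg | rfl
  · have hmem := fn_mem_parBlocks (B := {f : GateFn | f.1 ≤ C.maxFanIn}) (orBlocks C ℓ)
      (fun b hb g' hg' => by
        simp only [orBlocks, List.mem_ofFn] at hb
        obtain ⟨a, rfl⟩ := hb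
        exact arity_le_of_mem_hwGates C _ g' hg') g hg
    exact le_trans (show g.arity ≤ C.maxFanIn from hmem) (le_max_left _ _)
  · exact le_max_right _ _

end Circuit

end Literature.Computability.Complexity
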